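import Literature.MathematicalPhysics.QuantumFieldTheory.Balaban1983to89.Node00.TStepOfRecord
import Literature.MathematicalPhysics.QuantumFieldTheory.Balaban1983to89.Node00.RStepProvisosOfRecord
import Literature.MathematicalPhysics.QuantumFieldTheory.Balaban1983to89.Node00.StepWeightsOfRecord

/-!
# NODE 00 — THE T-STEP OF RECORD UNDER A.E. HYPOTHESES (`_ae` twins of `Node00/TStepOfRecord`): the `IsRT` face and the integrability of
# the T-stepped pieces from A.E.-strongly-measurable step weights and front factors with A.E. bounds, and the ESSENTIAL form of the
# (0.3) uniform-bound proviso

Cell `pub-ymgap`, seat `pub-ymgap-dag-n23-b` g3, dag-lead REBALANCE №45-R (the T-half of repair (R-a) in the seat's located note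
`K0-TYPING-CENSUS.md` v1.2 §3; plan's (I3-version-T) bar for `Record11`: «no conjunct of `Provisos` quantifies over an unpinned representative»).
[III] = [Balaban1988Convergent], [IV] = [Balaban1989LargeFieldI].  FILE 1 = `Node00/TStepOfRecord` (def-T), FILE 10 = `Node00/RStepProvisosOfRecord` (def-R).

WHY.  FILE 1 proves the `IsRT` face of the T-step (†) (`isRT_sum_texpASucc`, `isRT_tstepOfRecord`) and the integrability of the new pieces
(`integrable_piece_texpASucc`) from POINTWISE hypotheses: jointly `Measurable` step weights with `|w| ≤ 1` everywhere, `Measurable` new front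
factors with `|χ_{k+1}| ≤ 1` everywhere.  At the objects of record these pointwise clauses are the representative-dependent rows of the seat's
census (the χ's of record read def-R's `Classical.choose` solution map); the essential ∕ a.e. forms are what a successor record can state about
DETERMINED objects.  This file re-proves the two faces under the A.E. hypotheses — the only analytic input being the pull-back of
`dV′`-null sets to the joint law of `(Ū, U)`, which `HaarAC` (`(dU).map avg ≪ dV′`) provides — and types the ESSENTIAL form of FILE 10's
uniform-bound conjunct with its `of_pointwise` bridge.

* §1 (generic one step `avg` with `HaarAC`): `quasiMeasurePreserving_fst_jointLaw`, the a.e. pull-backs `ae_jointLaw_of_ae`, `ae_graph_of_ae_jointLaw`,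
  `ae_avg_of_ae`, `aestronglyMeasurable_comp_fst_jointLaw`; the piece lemmas `integrable_graph_piece_ae`, `integrable_transport_piece_ae`,
  `integral_transport_piece_ae`; the twins **`isRT_sum_texpASucc_ae`**, **`integrable_piece_texpASucc_ae`** (FILE 1's hypothesis order and names,
  `_ae` forms: `hw : AEStronglyMeasurable (fun z => w s′ z.2 z.1) (jointLaw dU avg)`, `hwb : ∀ᵐ z ∂jointLaw, |w s′ z.2 z.1| ≤ 1`,
  `hχ : AEStronglyMeasurable (χk1 s′) dV′`, `hχb : ∀ᵐ V′ ∂dV′, |χk1 s′ V′| ≤ 1`; the unity law stays pointwise — (3.2)·(3.3) are identities).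
* §2 (of record): `isRT_tstepOfRecord_ae`, `integrable_piece_tstepOfRecord_ae`, `aestronglyMeasurable_wOfRecord` (the `_ae` twin of n02-b's `measurable_wOfRecord`).
* §3 the ESSENTIAL-BOUND form of FILE 10's `rstep` conjunct 3: `EssBddPiecesOfRecord` (`∃ C, ∀ s, ∀ᵐ V, χ_k(s)·slot(s) ≤ C`), `essBddPiecesOfRecord_of_pointwise`,
  `essBddPiecesOfRecord_of_provisosSupp`.

## HONEST FRAMING — what this is NOT

* Kernel lemmas under WEAKER hypotheses + one displayed `def`; nothing of Bałaban's asserted ([III] §3 not used); no node count moves; the a.e.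
  hypotheses are still DISPLAYED where a record uses them (whether the χ's of record are a.e.-strongly measurable is a statement about a
  `Classical.choose`-defined object — see the seat's census §2; this file does not decide it).
* The R-half of (R-a) (a.e.-hypothesis variants of b01's `integral_ropReal_eq` ∕ FILE 10's faces, which need a measurable-modification device for
  `lmarginal`) is NOT here (def-R successor, REACTIVATE №5).
* One finite four-torus programme at fixed `ε` — NOT the continuum limit on ℝ⁴, NOT infinite volume, NOT OS, NOT a mass gap, NOT the Clay problem.
-/

noncomputable section

open MeasureTheory ProbabilityTheory
open scoped BigOperators NNReal ENNReal

namespace Literature.MathematicalPhysics.QuantumFieldTheory.Balaban1983to89.Node00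

open T4Continuum B14.Eq218Concrete T4AveragingDisintegration T4FiniteEpsInhabited

/-! ## §1 GENERIC: one averaging step under `HaarAC` — a.e. pull-backs and the `_ae` twins -/

section Generic

variable {P : Params} {G : Type*} [GaugeGroup G] [MeasurableSpace G] [HaarData G] [StandardBorelSpace G]
variable {α : Type*} {D : ℕ → Set (Set α)} {k : ℕ}
variable {avg : GaugeField P k G → GaugeField P (k + 1) G}

omit [StandardBorelSpace G] in
/-- **The coarse coordinate of the joint law of `(Ū, U)` is quasi-measure-preserving onto `dV′`** — the pull-back form of `HaarAC`
(`(dU).map avg ≪ dV′`; `jointLaw_fst`). [cite: Balaban1985Averaging, (10) p.19 (the push-forward reading of the averaging; bookkeeping)] -/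
theorem quasiMeasurePreserving_fst_jointLaw (havg : Measurable avg) (hac : HaarAC avg) :
    Measure.QuasiMeasurePreserving Prod.fst (jointLaw (fieldMeasure P k G) avg) (fieldMeasure P (k + 1) G) := by
  refine ⟨measurable_fst, ?_⟩
  have e : (jointLaw (fieldMeasure P k G) avg).map Prod.fst = (fieldMeasure P k G).map avg := jointLaw_fst _ havg
  rw [e]
  exact hac

omit [StandardBorelSpace G] in
/-- A `dV′`-a.e. property of the coarse field holds `jointLaw`-a.e. in the coarse coordinate. [cite: Balaban1985Averaging, (10) p.19 (bookkeeping)] -/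
theorem ae_jointLaw_of_ae (havg : Measurable avg) (hac : HaarAC avg) {p : GaugeField P (k + 1) G → Prop}
    (h : ∀ᵐ V ∂(fieldMeasure P (k + 1) G), p V) : ∀ᵐ z ∂(jointLaw (fieldMeasure P k G) avg), p z.1 :=
  (quasiMeasurePreserving_fst_jointLaw havg hac).ae h

omit [StandardBorelSpace G] in
/-- A `jointLaw`-a.e. property holds `dU`-a.e. on the graph `(Ū, U)` (the joint law IS the image of `dU` under the graph map `U ↦ (Ū, U)`).
[cite: Balaban1985Averaging, (10) p.19 (bookkeeping)] -/
theorem ae_graph_of_ae_jointLaw (havg : Measurable avg) {p : GaugeField P (k + 1) G × GaugeField P k G → Prop}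
    (h : ∀ᵐ z ∂(jointLaw (fieldMeasure P k G) avg), p z) : ∀ᵐ U ∂(fieldMeasure P k G), p (avg U, U) :=
  ae_of_ae_map (measurable_graphMap havg).aemeasurable h

omit [StandardBorelSpace G] in
/-- **A `dV′`-a.e. property of the coarse field holds for `dU`-a.e. fine field at `Ū`** (`HaarAC` pulled back along `avg`).
[cite: Balaban1985Averaging, (10) p.19 (bookkeeping)] -/
theorem ae_avg_of_ae (havg : Measurable avg) (hac : HaarAC avg) {p : GaugeField P (k + 1) G → Prop}
    (h : ∀ᵐ V ∂(fieldMeasure P (k + 1) G), p V) : ∀ᵐ U ∂(fieldMeasure P k G), p (avg U) :=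
  ae_graph_of_ae_jointLaw havg (ae_jointLaw_of_ae havg hac h)

omit [StandardBorelSpace G] in
/-- A `dV′`-a.e. strongly measurable function of the coarse field is a.e. strongly measurable on the joint law (as a function of the first
coordinate). [cite: Balaban1985Averaging, (10) p.19 (bookkeeping)] -/
theorem aestronglyMeasurable_comp_fst_jointLaw (havg : Measurable avg) (hac : HaarAC avg) {f : GaugeField P (k + 1) G → ℝ}
    (hf : AEStronglyMeasurable f (fieldMeasure P (k + 1) G)) :
    AEStronglyMeasurable (fun z : GaugeField P (k + 1) G × GaugeField P k G => f z.1) (jointLaw (fieldMeasure P k G) avg) :=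
  hf.comp_quasiMeasurePreserving (quasiMeasurePreserving_fst_jointLaw havg hac)

/-! ### The piece lemmas of FILE 1 under a.e. hypotheses -/

omit [StandardBorelSpace G] in
/-- Graph-side integrability of one piece (FILE 1 `integrable_graph_piece`, `_ae` form): an integrable `F` times a cofactor `b(Ū, U)` that is
a.e.-strongly measurable and a.e.-bounded ON THE JOINT LAW. [cite: Balaban1988Convergent, (3.1) p.264 (bookkeeping)] -/
theorem integrable_graph_piece_ae (havg : Measurable avg) {F : Density P k G} (hF : Integrable F (fieldMeasure P k G))
    {b : GaugeField P (k + 1) G × GaugeField P k G → ℝ} (hb : AEStronglyMeasurable b (jointLaw (fieldMeasure P k G) avg)) {C : ℝ}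
    (hbC : ∀ᵐ z ∂(jointLaw (fieldMeasure P k G) avg), ‖b z‖ ≤ C) :
    Integrable (fun U => F U * b (avg U, U)) (fieldMeasure P k G) :=
  hF.mul_bdd (hb.comp_aemeasurable (measurable_graphMap havg).aemeasurable) (ae_graph_of_ae_jointLaw havg hbC)

/-- Coarse-side integrability of the transported piece `V ↦ h(V) ∫ F(U) b(V,U) κ_V(dU)` (FILE 1 `integrable_transport_piece`, `_ae` form).
[cite: Balaban1988Convergent, (3.1) p.264 (bookkeeping)] -/
theorem integrable_transport_piece_ae (havg : Measurable avg) (hac : HaarAC avg) {F : Density P k G}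
    (hF : Integrable F (fieldMeasure P k G)) {b : GaugeField P (k + 1) G × GaugeField P k G → ℝ}
    (hb : AEStronglyMeasurable b (jointLaw (fieldMeasure P k G) avg)) {C : ℝ} (hbC : ∀ᵐ z ∂(jointLaw (fieldMeasure P k G) avg), ‖b z‖ ≤ C) :
    Integrable (fun V => (avgDensity avg V : ℝ) * ∫ U, F U * b (V, U) ∂(avgKernel avg V)) (fieldMeasure P (k + 1) G) := by
  have hgm : AEStronglyMeasurable (fun z : GaugeField P (k + 1) G × GaugeField P k G => F z.2 * b z)
      (jointLaw (fieldMeasure P k G) avg) :=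
    (aestronglyMeasurable_comp_snd_jointLaw _ havg hF.1).mul hb
  have hgi : Integrable (fun z : GaugeField P (k + 1) G × GaugeField P k G => F z.2 * b z)
      (jointLaw (fieldMeasure P k G) avg) :=
    (integrable_jointLaw_iff _ havg hgm).2 (integrable_graph_piece_ae havg hF hb hbC)
  have hI := (integrable_margDensity_mul (fieldMeasure P k G) (fieldMeasure P (k + 1) G) havg hac hgi).integral_compProd
  refine hI.congr (ae_of_all _ fun V => ?_)
  exact integral_const_mul ((avgDensity avg V : ℝ)) (fun U => F U * b (V, U))

/-- The integrated identity of one transported piece `∫ h(V) [∫ F b(V,·) dκ_V] dV = ∫ F(U) b(Ū,U) dU` (FILE 1 `integral_transport_piece`, `_ae` form).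
[cite: Balaban1988Convergent, (3.1) p.264 (bookkeeping)] -/
theorem integral_transport_piece_ae (havg : Measurable avg) (hac : HaarAC avg) {F : Density P k G}
    (hF : Integrable F (fieldMeasure P k G)) {b : GaugeField P (k + 1) G × GaugeField P k G → ℝ}
    (hb : AEStronglyMeasurable b (jointLaw (fieldMeasure P k G) avg)) {C : ℝ} (hbC : ∀ᵐ z ∂(jointLaw (fieldMeasure P k G) avg), ‖b z‖ ≤ C) :
    ∫ V, (avgDensity avg V : ℝ) * ∫ U, F U * b (V, U) ∂(avgKernel avg V) ∂(fieldMeasure P (k + 1) G)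
      = ∫ U, F U * b (avg U, U) ∂(fieldMeasure P k G) := by
  have hgm : AEStronglyMeasurable (fun z : GaugeField P (k + 1) G × GaugeField P k G => F z.2 * b z)
      (jointLaw (fieldMeasure P k G) avg) :=
    (aestronglyMeasurable_comp_snd_jointLaw _ havg hF.1).mul hb
  exact (integral_graph_eq (fieldMeasure P k G) (fieldMeasure P (k + 1) G) havg hac hgm
    (integrable_graph_piece_ae havg hF hb hbC)).symm

/-! ### The two faces of the step under a.e. hypotheses -/

/-- **THE STEP IS A RENORMALIZATION TRANSFORMATION — `_ae` twin of FILE 1's `isRT_sum_texpASucc`**: under the (pointwise) unity law, the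
assembled density `Σ_{s′} χ_{k+1}(s′)·texpASucc(s′)` is an `IsRT`-image along `avg` of `Σ_s χ_k(s)·T(s)` — for a measurable averaging with
`HaarAC`, integrable pieces, step weights A.E.-strongly measurable and A.E.-bounded by `1` ON THE JOINT LAW of `(Ū, U)`, and new front factors
`dV′`-A.E.-strongly measurable and `dV′`-A.E.-bounded by `1`. [cite: Balaban1988Convergent, (3.1) p.264, (3.25) p.270] -/
theorem isRT_sum_texpASucc_ae [Finite α] (havg : Measurable avg) (hac : HaarAC avg) (χk T : Seq D k → Density P k G)
    (χk1 : Seq D (k + 1) → Density P (k + 1) G) (w : Seq D (k + 1) → GaugeField P k G → GaugeField P (k + 1) G → ℝ)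
    (hT : ∀ s, Integrable (fun U => χk s U * T s U) (fieldMeasure P k G))
    (hw : ∀ s', AEStronglyMeasurable (fun z : GaugeField P (k + 1) G × GaugeField P k G => w s' z.2 z.1)
      (jointLaw (fieldMeasure P k G) avg))
    (hwb : ∀ s', ∀ᵐ z ∂(jointLaw (fieldMeasure P k G) avg), |w s' z.2 z.1| ≤ 1)
    (hχ : ∀ s', AEStronglyMeasurable (χk1 s') (fieldMeasure P (k + 1) G))
    (hχb : ∀ s', ∀ᵐ V' ∂(fieldMeasure P (k + 1) G), |χk1 s' V'| ≤ 1)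
    (hunit : IsStepUnity avg χk χk1 w) :
    IsRT avg (fun U => ∑ s, χk s U * T s U) (fun V' => ∑ s', χk1 s' V' * texpASucc avg χk T w s' V') := by
  classical
  intro f hf hfC
  obtain ⟨C, hC⟩ := hfC
  have hb : ∀ s', AEStronglyMeasurable
      (fun z : GaugeField P (k + 1) G × GaugeField P k G => w s' z.2 z.1 * (χk1 s' z.1 * f z.1)) (jointLaw (fieldMeasure P k G) avg) :=
    fun s' => (hw s').mul ((aestronglyMeasurable_comp_fst_jointLaw havg hac (hχ s')).mul
      (hf.comp measurable_fst).aestronglyMeasurable)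
  have hbC : ∀ s', ∀ᵐ z ∂(jointLaw (fieldMeasure P k G) avg), ‖w s' z.2 z.1 * (χk1 s' z.1 * f z.1)‖ ≤ C := by
    intro s'
    filter_upwards [hwb s', ae_jointLaw_of_ae havg hac (hχb s')] with z h1 h2
    rw [Real.norm_eq_abs, abs_mul, abs_mul]
    calc |w s' z.2 z.1| * (|χk1 s' z.1| * |f z.1|) ≤ 1 * (1 * C) :=
          mul_le_mul h1 (mul_le_mul h2 (hC _) (abs_nonneg _) zero_le_one)
            (mul_nonneg (abs_nonneg _) (abs_nonneg _)) zero_le_one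
      _ = C := by ring
  have e : ∀ s' V, χk1 s' V * texpASucc avg χk T w s' V * f V =
      (avgDensity avg V : ℝ) * ∫ U, (χk s'.init U * T s'.init U) * (w s' U V * (χk1 s' V * f V)) ∂(avgKernel avg V) := by
    intro s' V
    have : ∫ U, (χk s'.init U * T s'.init U) * (w s' U V * (χk1 s' V * f V)) ∂(avgKernel avg V)
        = (∫ U, w s' U V * (χk s'.init U * T s'.init U) ∂(avgKernel avg V)) * (χk1 s' V * f V) := by
      rw [← integral_mul_const]
      refine integral_congr_ae (ae_of_all _ fun U => ?_)
      ring
    rw [this, texpASucc_apply]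
    ring
  have step1 : ∀ V, (∑ s', χk1 s' V * texpASucc avg χk T w s' V) * f V =
      ∑ s', (avgDensity avg V : ℝ) *
        ∫ U, (χk s'.init U * T s'.init U) * (w s' U V * (χk1 s' V * f V)) ∂(avgKernel avg V) := by
    intro V
    rw [Finset.sum_mul]
    exact Finset.sum_congr rfl fun s' _ => e s' V
  have step2 : ∀ U, ∑ s', (χk s'.init U * T s'.init U) * (w s' U (avg U) * (χk1 s' (avg U) * f (avg U))) =
      (∑ s, χk s U * T s U) * f (avg U) := by
    intro U
    rw [Seq.sum_seq_succ_fiber, Finset.sum_mul]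
    refine Finset.sum_congr rfl fun s _ => ?_
    have hu := hunit s U
    calc ∑ s' ∈ Finset.univ.filter (fun s' : Seq D (k + 1) => s'.init = s),
          (χk s'.init U * T s'.init U) * (w s' U (avg U) * (χk1 s' (avg U) * f (avg U)))
        = ∑ s' ∈ Finset.univ.filter (fun s' : Seq D (k + 1) => s'.init = s),
            (T s U * f (avg U)) * (χk s U * (χk1 s' (avg U) * w s' U (avg U))) := by
          refine Finset.sum_congr rfl fun s' hs' => ?_
          rw [(Finset.mem_filter.1 hs').2]
          ring
      _ = (χk s U * T s U) * f (avg U) := by rw [← Finset.mul_sum, ← Finset.mul_sum, hu]; ring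
  calc ∫ V, (∑ s', χk1 s' V * texpASucc avg χk T w s' V) * f V ∂(fieldMeasure P (k + 1) G)
      = ∫ V, ∑ s', (avgDensity avg V : ℝ) *
          ∫ U, (χk s'.init U * T s'.init U) * (w s' U V * (χk1 s' V * f V)) ∂(avgKernel avg V)
            ∂(fieldMeasure P (k + 1) G) := integral_congr_ae (ae_of_all _ step1)
    _ = ∑ s', ∫ V, (avgDensity avg V : ℝ) *
          ∫ U, (χk s'.init U * T s'.init U) * (w s' U V * (χk1 s' V * f V)) ∂(avgKernel avg V)
            ∂(fieldMeasure P (k + 1) G) :=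
        integral_finsetSum _ fun s' _ => integrable_transport_piece_ae havg hac (hT s'.init) (hb s') (hbC s')
    _ = ∑ s', ∫ U, (χk s'.init U * T s'.init U) * (w s' U (avg U) * (χk1 s' (avg U) * f (avg U)))
          ∂(fieldMeasure P k G) :=
        Finset.sum_congr rfl fun s' _ => integral_transport_piece_ae havg hac (hT s'.init) (hb s') (hbC s')
    _ = ∫ U, ∑ s', (χk s'.init U * T s'.init U) * (w s' U (avg U) * (χk1 s' (avg U) * f (avg U)))
          ∂(fieldMeasure P k G) :=
        (integral_finsetSum _ fun s' _ => integrable_graph_piece_ae havg (hT s'.init) (hb s') (hbC s')).symm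
    _ = ∫ U, (∑ s, χk s U * T s U) * f (avg U) ∂(fieldMeasure P k G) := integral_congr_ae (ae_of_all _ step2)

/-- **The new pieces `χ_{k+1}(s′)·texpASucc(s′)` are INTEGRABLE — `_ae` twin of FILE 1's `integrable_piece_texpASucc`**: integrable old piece,
step weight a.e.-strongly measurable and a.e.-bounded by `1` on the joint law, new front factor `dV′`-a.e.-strongly measurable and a.e.-bounded
by `1`. [cite: Balaban1988Convergent, (3.25) p.270 (bookkeeping)] -/
theorem integrable_piece_texpASucc_ae (havg : Measurable avg) (hac : HaarAC avg) (χk T : Seq D k → Density P k G)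
    (χk1 : Seq D (k + 1) → Density P (k + 1) G) (w : Seq D (k + 1) → GaugeField P k G → GaugeField P (k + 1) G → ℝ)
    (s' : Seq D (k + 1)) (hT : Integrable (fun U => χk s'.init U * T s'.init U) (fieldMeasure P k G))
    (hw : AEStronglyMeasurable (fun z : GaugeField P (k + 1) G × GaugeField P k G => w s' z.2 z.1) (jointLaw (fieldMeasure P k G) avg))
    (hwb : ∀ᵐ z ∂(jointLaw (fieldMeasure P k G) avg), |w s' z.2 z.1| ≤ 1)
    (hχ : AEStronglyMeasurable (χk1 s') (fieldMeasure P (k + 1) G)) (hχb : ∀ᵐ V' ∂(fieldMeasure P (k + 1) G), |χk1 s' V'| ≤ 1) :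
    Integrable (fun V' => χk1 s' V' * texpASucc avg χk T w s' V') (fieldMeasure P (k + 1) G) := by
  have hb : AEStronglyMeasurable (fun z : GaugeField P (k + 1) G × GaugeField P k G => w s' z.2 z.1 * χk1 s' z.1)
      (jointLaw (fieldMeasure P k G) avg) :=
    hw.mul (aestronglyMeasurable_comp_fst_jointLaw havg hac hχ)
  have hbC : ∀ᵐ z ∂(jointLaw (fieldMeasure P k G) avg), ‖w s' z.2 z.1 * χk1 s' z.1‖ ≤ 1 := by
    filter_upwards [hwb, ae_jointLaw_of_ae havg hac hχb] with z h1 h2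
    rw [Real.norm_eq_abs, abs_mul]
    calc |w s' z.2 z.1| * |χk1 s' z.1| ≤ 1 * 1 := mul_le_mul h1 h2 (abs_nonneg _) zero_le_one
      _ = 1 := by ring
  refine (integrable_transport_piece_ae havg hac hT hb hbC).congr (ae_of_all _ fun V => ?_)
  have : ∫ U, (χk s'.init U * T s'.init U) * (w s' U V * χk1 s' V) ∂(avgKernel avg V)
      = (∫ U, w s' U V * (χk s'.init U * T s'.init U) ∂(avgKernel avg V)) * χk1 s' V := by
    rw [← integral_mul_const]
    refine integral_congr_ae (ae_of_all _ fun U => ?_)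
    ring
  show (avgDensity avg V : ℝ) * ∫ U, (χk s'.init U * T s'.init U) * (w s' U V * χk1 s' V) ∂(avgKernel avg V)
    = χk1 s' V * texpASucc avg χk T w s' V
  rw [this, texpASucc_apply]
  ring

end Generic

/-! ## §2 OF RECORD: the T-step of record under a.e. hypotheses -/

section OfRecord

variable (F : T4Family) (N : ℕ) [NeZero N] (ν : Stage7Numerics) (M : ℕ)

/-- **`_ae` twin of FILE 1's `isRT_tstepOfRecord`**: the T-step of record IS an RT at the level of assembled densities, for `k < K` (so that
`avOfRecord_haarAC` applies), integrable level-k pieces, step weights a.e.-strongly measurable and a.e.-bounded on the joint law, new front factors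
a.e.-strongly measurable (they are bounded by `1` everywhere: `abs_chiSeqOfRecord_le_one`), and the pointwise unity law.
[cite: Balaban1988Convergent, (3.1) p.264, (3.25) p.270] -/
theorem isRT_tstepOfRecord_ae (w : StepWeightsOfRecord F N ν M) (p : B12.RunParams) (g : ℕ → ℝ) (k : ℕ) (hk : k < p.K)
    (T : SeqOfRecord F ν M g p.K k → Density (F.P p.K) k (SU N))
    (hT : ∀ s, Integrable (fun U => chiSeqOfRecord F N ν M g p.K k s U * T s U) (fieldMeasure (F.P p.K) k (SU N)))
    (hw : ∀ s', AEStronglyMeasurable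
      (fun z : GaugeField (F.P p.K) (k + 1) (SU N) × GaugeField (F.P p.K) k (SU N) => w p g k s' z.2 z.1)
      (jointLaw (fieldMeasure (F.P p.K) k (SU N)) (avOfRecord F N p.K k).avg))
    (hwb : ∀ s', ∀ᵐ z ∂(jointLaw (fieldMeasure (F.P p.K) k (SU N)) (avOfRecord F N p.K k).avg), |w p g k s' z.2 z.1| ≤ 1)
    (hχ : ∀ s', AEStronglyMeasurable (chiSeqOfRecord F N ν M g p.K (k + 1) s') (fieldMeasure (F.P p.K) (k + 1) (SU N)))
    (hunit : IsStepUnity (avOfRecord F N p.K k).avg (chiSeqOfRecord F N ν M g p.K k)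
      (chiSeqOfRecord F N ν M g p.K (k + 1)) (w p g k)) :
    IsRT (avOfRecord F N p.K k).avg (fun U => ∑ s, chiSeqOfRecord F N ν M g p.K k s U * T s U)
      (fun V' => ∑ s', chiSeqOfRecord F N ν M g p.K (k + 1) s' V' * tstepOfRecord F N ν M w p g k T s' V') :=
  isRT_sum_texpASucc_ae (avOfRecord_measurable F N p.K k) (avOfRecord_haarAC F N p.K k hk) _ T _ _ hT hw hwb hχ
    (fun s' => ae_of_all _ fun V' => abs_chiSeqOfRecord_le_one F N ν M g p.K (k + 1) s' V') hunit

/-- **`_ae` form of the integrability of the T-stepped pieces of record** (`χ_{k+1}(s′)·(T-step of T)(s′)` integrable, `k < K`).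
[cite: Balaban1988Convergent, (3.25) p.270 (bookkeeping)] -/
theorem integrable_piece_tstepOfRecord_ae (w : StepWeightsOfRecord F N ν M) (p : B12.RunParams) (g : ℕ → ℝ) (k : ℕ) (hk : k < p.K)
    (T : SeqOfRecord F ν M g p.K k → Density (F.P p.K) k (SU N)) (s' : SeqOfRecord F ν M g p.K (k + 1))
    (hT : Integrable (fun U => chiSeqOfRecord F N ν M g p.K k s'.init U * T s'.init U) (fieldMeasure (F.P p.K) k (SU N)))
    (hw : AEStronglyMeasurable
      (fun z : GaugeField (F.P p.K) (k + 1) (SU N) × GaugeField (F.P p.K) k (SU N) => w p g k s' z.2 z.1)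
      (jointLaw (fieldMeasure (F.P p.K) k (SU N)) (avOfRecord F N p.K k).avg))
    (hwb : ∀ᵐ z ∂(jointLaw (fieldMeasure (F.P p.K) k (SU N)) (avOfRecord F N p.K k).avg), |w p g k s' z.2 z.1| ≤ 1)
    (hχ : AEStronglyMeasurable (chiSeqOfRecord F N ν M g p.K (k + 1) s') (fieldMeasure (F.P p.K) (k + 1) (SU N))) :
    Integrable (fun V' => chiSeqOfRecord F N ν M g p.K (k + 1) s' V' * tstepOfRecord F N ν M w p g k T s' V')
      (fieldMeasure (F.P p.K) (k + 1) (SU N)) :=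
  integrable_piece_texpASucc_ae (avOfRecord_measurable F N p.K k) (avOfRecord_haarAC F N p.K k hk) _ T _ (w p g k) s' hT hw hwb hχ
    (ae_of_all _ fun V' => abs_chiSeqOfRecord_le_one F N ν M g p.K (k + 1) s' V')

/-- **The step weights of record are a.e.-strongly measurable from a.e.-strongly measurable label weights** (the `_ae` twin of n02-b's
`measurable_wOfRecord`: `w(s′) = Σ_t ω(init s′, t)` is a finite sum), for ANY measure on (coarse × fine) fields — at the record, the joint law.
[cite: Balaban1988Convergent, (3.2)–(3.5) p.265 (bookkeeping)] -/
theorem aestronglyMeasurable_wOfRecord (A₁ : ℝ) (ζ : ZetaOfRecord F N ν M) (p : B12.RunParams) (g : ℕ → ℝ) (k : ℕ)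
    {μ : Measure (GaugeField (F.P p.K) (k + 1) (SU N) × GaugeField (F.P p.K) k (SU N))}
    (hω : ∀ (s : SeqOfRecord F ν M g p.K k) (t : LbOfRecord F ν p g k),
      AEStronglyMeasurable (fun z : GaugeField (F.P p.K) (k + 1) (SU N) × GaugeField (F.P p.K) k (SU N) =>
        ωOfRecord F N ν M p g k A₁ ζ s t z.2 z.1) μ)
    (s' : SeqOfRecord F ν M g p.K (k + 1)) :
    AEStronglyMeasurable (fun z : GaugeField (F.P p.K) (k + 1) (SU N) × GaugeField (F.P p.K) k (SU N) =>
      wOfRecord F N ν M A₁ ζ p g k s' z.2 z.1) μ := by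
  simp only [wOfRecord_apply]
  unfold resumWeights
  exact Finset.aestronglyMeasurable_fun_sum _ (fun t _ => hω _ t)

/-! ## §3 The ESSENTIAL form of the (0.3) uniform-bound proviso (FILE 10's `rstep` conjunct 3) -/

variable (τ : TowerNumerics)

/-- **ESSENTIALLY BOUNDED PIECES** of a slot family at run `p`, couplings `g`, step `k`: `∃ C, ∀ s, χ_k(s)·slot(s) ≤ C` for `dV`-ALMOST EVERY
`V` — the essential form of FILE 10's third (0.3) proviso conjunct (`provisosSupp_towerRepOfRecord_iff`), which asks the bound at EVERY `V`
(a statement about the chosen representative where the slot reads an `rnDeriv` version).  A displayed `Prop`, never asserted.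
[cite: Balaban1989LargeFieldI, (0.3) p.176 (the proviso «uniformly bounded», essential reading)] -/
def EssBddPiecesOfRecord (texpA : TexpAOfRecord F N ν M) (p : B12.RunParams) (g : ℕ → ℝ) (k : ℕ) : Prop :=
  ∃ C : ℝ, ∀ s : SeqOfRecord F ν M g p.K k, ∀ᵐ V ∂(fieldMeasure (F.P p.K) k (SU N)),
    chiSeqOfRecord F N ν M g p.K k s V * texpA p g k s V ≤ C

/-- The pointwise bound (as typed in FILE 10) implies the essential one. [cite: Balaban1989LargeFieldI, (0.3) p.176 (bookkeeping)] -/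
theorem essBddPiecesOfRecord_of_pointwise (texpA : TexpAOfRecord F N ν M) (p : B12.RunParams) (g : ℕ → ℝ) (k : ℕ)
    (h : ∃ C : ℝ, ∀ (s : SeqOfRecord F ν M g p.K k) (V : GaugeField (F.P p.K) k (SU N)),
      chiSeqOfRecord F N ν M g p.K k s V * texpA p g k s V ≤ C) :
    EssBddPiecesOfRecord F N ν M texpA p g k := by
  obtain ⟨C, hC⟩ := h
  exact ⟨C, fun s => ae_of_all _ (hC s)⟩

/-- FILE 10's support-form (0.3) provisos (as typed) imply the essential bound. [cite: Balaban1989LargeFieldI, (0.3) p.176 (bookkeeping)] -/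
theorem essBddPiecesOfRecord_of_provisosSupp (texpA : TexpAOfRecord F N ν τ.M) (ppSel : PpSelOfRecord F ν τ.M)
    (p : B12.RunParams) (g : ℕ → ℝ) (k : ℕ) [DecidableEq (PBond (F.P p.K) k)]
    (h : (towerRepOfRecord F N ν τ texpA ppSel p g k).toRepData.ProvisosSupp) :
    EssBddPiecesOfRecord F N ν τ.M texpA p g k :=
  essBddPiecesOfRecord_of_pointwise F N ν τ.M texpA p g k ((provisosSupp_towerRepOfRecord_iff F N ν τ texpA ppSel p g k).1 h).2.2.1

end OfRecord

end Literature.MathematicalPhysics.QuantumFieldTheory.Balaban1983to89.Node00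

end
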